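import Literature.Combinatorics.Enumerative.MultivariateAperyDigitReductionProofs
import Mathlib.NumberTheory.Padics.PadicIntegers
import Mathlib.NumberTheory.Padics.RingHoms
import Mathlib.Tactic
import HarnessLib

/-!
# Straub 2014, proof of Theorem 1.2: `G₀(p^r 𝐧) = Σ_{p∤k} A(p^r 𝐧; k) ≡ 0 (mod p^{3r})` (λ = (2,2))

Topic `Literature/Combinatorics/Enumerative`, namespace `Literature.Combinatorics.Enumerative.MultivariateAperyPrimePowerProofs`
(sequel of `MultivariateAperyDigitReductionProofs`). PROOF FILE: sorry-free theorems only — no definition, no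
named fact. Source read on the page (held `paper:arxiv-1401.0854` §5, pp. 13–14): [Straub2014]. HONEST FRAMING
(cell pub-zeta5): classical congruences for Apéry-type numbers; nothing about `ζ(5)`.

## What is printed (verbatim, [Straub2014] proof of Theorem 1.2, the case `ℓ = 2`, `max λ ≤ 2`, `p ≥ 5`)

«To prove that `A_{λ,ε}(p^r 𝐧) ≡ A_{λ,ε}(p^{r−1} 𝐧)` modulo `p^{3r}`, we have to show that `G₀(p^r 𝐧) ≡ 0`
modulo `p^{3r}`. … Using the basic identity `C(m₁, k) = (m₁/k) C(m₁ − 1, k − 1)`, it is clear that the numbers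
`B_λ(𝐧; k) = k²/(n₁ n_{1+λ₁}) A_λ(𝐧; k)` are integers. Moreover … the integers `C_λ(𝐧; k) = B_λ(𝐧; k + 1)`
satisfy, for all `k, r ∈ ℤ` with `r ≥ 0`, `C(p^r 𝐧; k) ≡ C(p^{r−1} 𝐧; [k/p]) (mod p^r)`. If `p ∤ k` then
`[(k − 1)/p] = [k/p]` so that, in particular, `C(p^r 𝐧, k − 1) ≡ C(p^r 𝐧, [k/p]) ≡ C(p^r 𝐧; k) (mod p^r)`.
By construction, `G₀(p^r 𝐧) = p^{2r} n₁ n_{1+λ₁} Σ_{p∤k} (ε^k/k²) C(p^r 𝐧; k − 1)`, so that … it suffices to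
prove (46) `Σ_{p∤k} (ε^k/k²) C(p^r 𝐧; k) ≡ 0 (mod p^r)`. Define `a_k = ε^k/k²`, if `p ∤ k`, and `a_k = 0`
otherwise. Since `p ≥ 5`, it follows from Lemma 5.2 that, for all `l, s ∈ ℤ` with `s ≥ 0`,
`Σ_{[k/p^s] = l} a_k … ≡ 0 (mod p^s)`. Hence, the conditions of Lemma 5.6 are met, allowing us to conclude that
`Σ_{p∤k} (ε^k/k²) C(p^r 𝐧; k) = Σ_l Σ_{[k/p^r] = l} a_k C(p^r 𝐧; k) ≡ 0 (mod p^r)`.»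

RENDERING: `a_k = k⁻²` lives in Mathlib's `ℤ_[p]` as `(Ring.inverse k)²` (`= 0` exactly when `p ∣ k`); the
tree's Lemma 5.6 (`sum_block_dvd`) is applied over `R = ℤ_[p]`, Lemma 5.2 (`sum_units_inv_sq_eq_zero`, in `ℤ/p^s`)
is transported along `PadicInt.toZModPow s`, and the result returns to `ℤ` by `PadicInt.pow_p_dvd_int_iff`; `ε = 1`.

* `sq_mul_term_eq` — `k² A(𝐦; k) = m₁ m₃ B(𝐦; k)`; `block_sum_weights` — the block sums of the weights;
  `pow_dvd_sum_weights_companion` — (46); **`pow_dvd_sum_not_dvd_term`** — `p^{3r} ∣ G₀(p^r 𝐧)` (stated as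
  the sum over `0 ≤ k ≤ p^r n₁` of `A(p^r 𝐧; k)` with the terms `p ∣ k` replaced by `0`).
-/

open Finset

namespace Literature.Combinatorics.Enumerative.MultivariateAperyPrimePowerProofs

open MultivariateAperyNumbers (sum_block_dvd block sum_units_inv_sq_eq_zero)

section GZero

variable {p : ℕ} [hp : Fact p.Prime]

/-- Absorption, «the basic identity `C(m₁, k) = (m₁/k) C(m₁ − 1, k − 1)`»: `m · C(m − 1, k − 1) = C(m, k) · k`
for `k ≥ 1` (all `m`). [cite: Straub2014, Theorem 1.2 (proof)] -/
theorem mul_choose_sub_one {m k : ℕ} (hk : 1 ≤ k) : m * (m - 1).choose (k - 1) = m.choose k * k := by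
  rcases Nat.eq_zero_or_pos m with hm | hm
  · subst hm
    rw [zero_mul, Nat.choose_eq_zero_of_lt (by omega), zero_mul]
  · have h := Nat.add_one_mul_choose_eq (m - 1) (k - 1)
    rwa [Nat.sub_add_cancel hm, Nat.sub_add_cancel hk] at h

/-- **«Using the basic identity `C(m₁, k) = (m₁/k) C(m₁ − 1, k − 1)` it is clear that the numbers
`B_λ(𝐧; k) = k²/(n₁ n₃) · A_λ(𝐧; k)` are integers»** (λ = (2,2)): for `k ≥ 1`,
`k² · A(𝐦; k) = m₁ m₃ · C(m₁−1, k−1) C(m₃−1, k−1) C(m₁+m₂−k, m₁) C(m₃+m₄−k, m₃)`.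
[cite: Straub2014, Theorem 1.2 (proof)] -/
theorem sq_mul_term_eq {m₁ m₂ m₃ m₄ k : ℕ} (hk : 1 ≤ k) :
    k ^ 2 * (m₁.choose k * m₃.choose k * (m₁ + m₂ - k).choose m₁ * (m₃ + m₄ - k).choose m₃) =
      m₁ * m₃ * ((m₁ - 1).choose (k - 1) * (m₃ - 1).choose (k - 1) *
        (m₁ + m₂ - k).choose m₁ * (m₃ + m₄ - k).choose m₃) := by
  have h1 := mul_choose_sub_one (m := m₁) hk
  have h3 := mul_choose_sub_one (m := m₃) hk
  calc k ^ 2 * (m₁.choose k * m₃.choose k * (m₁ + m₂ - k).choose m₁ * (m₃ + m₄ - k).choose m₃)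
      = (m₁.choose k * k) * (m₃.choose k * k) * ((m₁ + m₂ - k).choose m₁ * (m₃ + m₄ - k).choose m₃) := by ring
    _ = (m₁ * (m₁ - 1).choose (k - 1)) * (m₃ * (m₃ - 1).choose (k - 1)) *
          ((m₁ + m₂ - k).choose m₁ * (m₃ + m₄ - k).choose m₃) := by rw [h1, h3]
    _ = _ := by ring

omit hp in
/-- A natural number is a unit of `ℤ_p` iff it is prime to `p`. [folklore] -/
private theorem isUnit_natCast_padicInt_iff [Fact p.Prime] (K : ℕ) : IsUnit ((K : ℤ_[p])) ↔ ¬ p ∣ K := by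
  rw [PadicInt.isUnit_iff, ← PadicInt.norm_natCast_lt_one_iff (p := p)]
  have := PadicInt.norm_le_one ((K : ℤ_[p]))
  constructor
  · intro h; rw [h]; exact lt_irrefl 1
  · intro h; exact le_antisymm this (not_lt.mp h)

/-- `Ring.inverse k · k = 1` in `ℤ_p` for `p ∤ k`, and `Ring.inverse k = 0` for `p ∣ k`. [folklore] -/
private theorem ringInverse_natCast_mul_self {K : ℕ} (hK : ¬ p ∣ K) :
    Ring.inverse ((K : ℤ_[p])) * (K : ℤ_[p]) = 1 :=
  Ring.inverse_mul_cancel _ ((isUnit_natCast_padicInt_iff K).mpr hK)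

/-- [folklore] -/
private theorem ringInverse_natCast_of_dvd {K : ℕ} (hK : p ∣ K) : Ring.inverse ((K : ℤ_[p])) = 0 :=
  Ring.inverse_non_unit _ (fun h => (isUnit_natCast_padicInt_iff K).mp h hK)

/-- Reduction modulo `p^s` commutes with `Ring.inverse` on natural numbers (`s ≥ 1`). [folklore] -/
private theorem toZModPow_ringInverse_natCast {s : ℕ} (hs : 1 ≤ s) (K : ℕ) :
    PadicInt.toZModPow s (Ring.inverse ((K : ℤ_[p]))) = Ring.inverse ((K : ZMod (p ^ s))) := by
  by_cases hK : p ∣ K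
  · rw [ringInverse_natCast_of_dvd hK, map_zero, Ring.inverse_non_unit]
    intro hu
    rw [ZMod.isUnit_iff_coprime, Nat.coprime_pow_right_iff (by omega), Nat.coprime_comm,
      Nat.Prime.coprime_iff_not_dvd hp.out] at hu
    exact hu hK
  · obtain ⟨u, hu⟩ := (isUnit_natCast_padicInt_iff K).mpr hK
    set ψ : ℤ_[p] →* ZMod (p ^ s) := (PadicInt.toZModPow s).toMonoidHom with hψ
    have hval : ((Units.map ψ u : (ZMod (p ^ s))ˣ) : ZMod (p ^ s)) = (K : ZMod (p ^ s)) := by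
      rw [Units.coe_map, hψ, RingHom.toMonoidHom_eq_coe, MonoidHom.coe_coe, hu, map_natCast]
    calc PadicInt.toZModPow s (Ring.inverse ((K : ℤ_[p])))
        = ψ ((u⁻¹ : ℤ_[p]ˣ) : ℤ_[p]) := by rw [← hu, Ring.inverse_unit]; rfl
      _ = ((Units.map ψ u)⁻¹ : (ZMod (p ^ s))ˣ) := (Units.coe_map_inv ψ u).symm
      _ = Ring.inverse ((Units.map ψ u : (ZMod (p ^ s))ˣ) : ZMod (p ^ s)) := (Ring.inverse_unit _).symm
      _ = Ring.inverse ((K : ZMod (p ^ s))) := by rw [hval]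

/-- In `ℤ/p^s`, `(Ring.inverse x)² = x⁻²` for units and `0` otherwise. [folklore] -/
private theorem ringInverse_sq_zmod {s : ℕ} (x : ZMod (p ^ s)) :
    (Ring.inverse x) ^ 2 = if IsUnit x then (x⁻¹) ^ 2 else 0 := by
  split_ifs with h
  · obtain ⟨u, rfl⟩ := h
    rw [Ring.inverse_unit, ZMod.inv_coe_unit]
  · rw [Ring.inverse_non_unit _ h, zero_pow two_ne_zero]

/-- **The weights `a_k = k⁻²` (p ∤ k) have vanishing block sums** (Straub, proof of Thm 1.2, from Lemma 5.2):
in `ℤ_p`, for `p ≥ 5` and all `s ≥ 0`, `l ∈ ℤ`, `p^s ∣ Σ_{[k/p^s] = l} a_k`, where `a_k = (Ring.inverse k)²` for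
`k > 0` and `a_k = 0` for `k ≤ 0`. [cite: Straub2014, Theorem 1.2 (proof, «the conditions of Lemma 5.6 are met»)] -/
theorem block_sum_weights (h5 : 5 ≤ p) (s : ℕ) (l : ℤ) :
    (p : ℤ_[p]) ^ s ∣ ∑ k ∈ block p l s,
      (if 0 < k then (Ring.inverse (((k.toNat : ℕ) : ℤ_[p]))) ^ 2 else 0) := by
  have hp' := hp.out
  rcases Nat.eq_zero_or_pos s with hs | hs
  · subst hs; rw [pow_zero]; exact one_dvd _
  -- negative blocks contribute nothing
  rcases lt_or_ge l 0 with hl | hl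
  · rw [Finset.sum_eq_zero]
    · exact dvd_zero _
    · intro k hk
      rw [block, Finset.mem_Ico] at hk
      have : k < 0 := by
        have h1 : (l + 1) * (p : ℤ) ^ s ≤ 0 := mul_nonpos_of_nonpos_of_nonneg (by omega) (by positivity)
        linarith [hk.2]
      rw [if_neg (by omega)]
  -- nonnegative blocks: reindex by `k = l p^s + j`, `j < p^s`
  obtain ⟨L, rfl⟩ := Int.eq_ofNat_of_zero_le hl
  have hreindex : ∑ k ∈ block p (L : ℤ) s, (if 0 < k then (Ring.inverse (((k.toNat : ℕ) : ℤ_[p]))) ^ 2 else 0) =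
      ∑ j ∈ range (p ^ s), (if 0 < L * p ^ s + j then (Ring.inverse (((L * p ^ s + j : ℕ) : ℤ_[p]))) ^ 2 else 0) := by
    rw [block]
    have hset : Finset.Ico ((L : ℤ) * (p : ℤ) ^ s) (((L : ℤ) + 1) * (p : ℤ) ^ s) =
        (range (p ^ s)).image (fun j : ℕ => ((L * p ^ s + j : ℕ) : ℤ)) := by
      ext k
      simp only [Finset.mem_Ico, Finset.mem_image, Finset.mem_range]
      constructor
      · rintro ⟨h1, h2⟩
        refine ⟨(k - L * p ^ s).toNat, ?_, ?_⟩
        · have : k - (L : ℤ) * (p : ℤ) ^ s < (p : ℤ) ^ s := by linarith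
          have h0 : 0 ≤ k - (L : ℤ) * (p : ℤ) ^ s := by linarith
          zify
          rw [Int.toNat_of_nonneg h0]
          exact this
        · push_cast
          rw [Int.toNat_of_nonneg (by linarith)]
          ring
      · rintro ⟨j, hj, rfl⟩
        push_cast
        constructor
        · linarith
        · have : (j : ℤ) < (p : ℤ) ^ s := by exact_mod_cast hj
          linarith
    rw [hset, Finset.sum_image (fun a _ b _ h => by simpa using h)]
    refine Finset.sum_congr rfl fun j _ => ?_
    simp only [Int.toNat_natCast, Nat.cast_pos]
  rw [hreindex]
  -- reduce modulo `p^s`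
  rw [← Ideal.mem_span_singleton, ← PadicInt.ker_toZModPow, RingHom.mem_ker, map_sum]
  have hterm : ∀ j ∈ range (p ^ s), PadicInt.toZModPow s
      (if 0 < L * p ^ s + j then (Ring.inverse (((L * p ^ s + j : ℕ) : ℤ_[p]))) ^ 2 else 0) =
      (Ring.inverse ((j : ZMod (p ^ s)))) ^ 2 := by
    intro j _
    have hj : ((L * p ^ s + j : ℕ) : ZMod (p ^ s)) = (j : ZMod (p ^ s)) := by
      have hps : ((p : ZMod (p ^ s))) ^ s = 0 := by rw [← Nat.cast_pow, ZMod.natCast_self]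
      push_cast
      rw [hps, mul_zero, zero_add]
    split_ifs with h0
    · rw [map_pow, toZModPow_ringInverse_natCast hs, hj]
    · have hj0 : j = 0 := by omega
      have : (j : ZMod (p ^ s)) = 0 := by rw [hj0, Nat.cast_zero]
      rw [map_zero, this, Ring.inverse_zero, zero_pow two_ne_zero]
  rw [Finset.sum_congr rfl hterm]
  haveI : NeZero (p ^ s) := ⟨pow_ne_zero _ hp'.ne_zero⟩
  have hfin := sum_units_inv_sq_eq_zero (p := p) h5 s
  rw [← Finset.sum_congr rfl (fun x _ => ringInverse_sq_zmod x)] at hfin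
  rw [← hfin]
  exact Finset.sum_nbij' (fun k : ℕ => (k : ZMod (p ^ s))) (fun x : ZMod (p ^ s) => x.val)
    (fun _ _ => Finset.mem_univ _) (fun x _ => Finset.mem_range.mpr (ZMod.val_lt x))
    (fun k hk => ZMod.val_natCast_of_lt (Finset.mem_range.mp hk)) (fun x _ => ZMod.natCast_zmod_val x)
    (fun _ _ => rfl)


omit hp in
/-- «`Σ_l Σ_{[k/p^r] = l}`»: summing over the blocks `[k/p^r] = l`, `0 ≤ l < L`, is summing over
`0 ≤ k < L p^r`. [cite: Straub2014, Theorem 1.2 (proof, last display)] -/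
theorem sum_range_blocks {M : Type*} [AddCommMonoid M] (hp0 : 0 < p) (r : ℕ) (f : ℤ → M) :
    ∀ L : ℕ, ∑ l ∈ range L, ∑ k ∈ block p (l : ℤ) r, f k = ∑ k ∈ range (L * p ^ r), f (k : ℤ)
  | 0 => by simp
  | L + 1 => by
    rw [sum_range_succ, sum_range_blocks hp0 r f L, Nat.succ_mul, sum_range_add]
    congr 1
    rw [block]
    have hset : Finset.Ico ((L : ℤ) * (p : ℤ) ^ r) (((L : ℕ) + 1 : ℤ) * (p : ℤ) ^ r) =
        (range (p ^ r)).image (fun j : ℕ => ((L * p ^ r + j : ℕ) : ℤ)) := by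
      ext k
      simp only [Finset.mem_Ico, Finset.mem_image, Finset.mem_range]
      constructor
      · rintro ⟨h1, h2⟩
        refine ⟨(k - L * p ^ r).toNat, ?_, ?_⟩
        · have : k - (L : ℤ) * (p : ℤ) ^ r < (p : ℤ) ^ r := by linarith
          have h0 : 0 ≤ k - (L : ℤ) * (p : ℤ) ^ r := by linarith
          zify
          rw [Int.toNat_of_nonneg h0]
          exact this
        · push_cast
          rw [Int.toNat_of_nonneg (by linarith)]
          ring
      · rintro ⟨j, hj, rfl⟩
        push_cast
        constructor
        · linarith
        · have : (j : ℤ) < (p : ℤ) ^ r := by exact_mod_cast hj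
          linarith
    rw [hset, Finset.sum_image (fun a _ b _ h => by simpa using h)]

omit hp in
/-- If `p ∤ k` and `k ≥ 1` then `[(k−1)/p] = [k/p]`. [cite: Straub2014, Theorem 1.2 (proof: «if p ∤ k then
[(k−1)/p] = [k/p]»)] -/
theorem sub_one_div_eq {k : ℕ} (hk : 1 ≤ k) (hpk : ¬ p ∣ k) : (k - 1) / p = k / p := by
  obtain ⟨j, rfl⟩ : ∃ j, k = j + 1 := ⟨k - 1, by omega⟩
  rw [Nat.add_sub_cancel, Nat.succ_div_of_not_dvd hpk]

/-- **`p^r` divides the weighted companion sum** `Σ_{0 ≤ k < n₁ p^r} a_k C(p^r 𝐧; k)` in `ℤ_p`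
(`a_k = k⁻²` for `p ∤ k`, `0` otherwise) — Lemma 5.6 applied with Lemma 5.2's weights and the digitwise
reduction of `C(p^r 𝐧; k)` (λ = (2,2); `p ≥ 5`, `r ≥ 1`, `n₁, n₃ ≥ 1`).
[cite: Straub2014, Theorem 1.2 (proof, (46))] -/
theorem pow_dvd_sum_weights_companion (h5 : 5 ≤ p) (r : ℕ) {n₁ n₃ : ℕ} (hn₁ : 1 ≤ n₁)
    (hn₃ : 1 ≤ n₃) (n₂ n₄ : ℕ) :
    (p : ℤ_[p]) ^ r ∣ ∑ k ∈ range (n₁ * p ^ r),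
      (Ring.inverse ((k : ℤ_[p]))) ^ 2 *
        (((p ^ r * n₁ - 1).choose k * (p ^ r * n₃ - 1).choose k *
          (p ^ r * n₁ + p ^ r * n₂ - k - 1).choose (p ^ r * n₁) *
          (p ^ r * n₃ + p ^ r * n₄ - k - 1).choose (p ^ r * n₃) : ℕ) : ℤ_[p]) := by
  have hp' := hp.out
  have hp0 : 0 < p := hp'.pos
  -- the companion integers as a function `ℕ → ℤ → ℤ_p`
  set Cf : ℕ → ℤ → ℤ_[p] := fun ρ k => if 0 ≤ k then
      (((p ^ ρ * n₁ - 1).choose k.toNat * (p ^ ρ * n₃ - 1).choose k.toNat *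
        (p ^ ρ * n₁ + p ^ ρ * n₂ - k.toNat - 1).choose (p ^ ρ * n₁) *
        (p ^ ρ * n₃ + p ^ ρ * n₄ - k.toNat - 1).choose (p ^ ρ * n₃) : ℕ) : ℤ_[p]) else 0 with hCf
  set a : ℤ → ℤ_[p] := fun k => if 0 < k then (Ring.inverse (((k.toNat : ℕ) : ℤ_[p]))) ^ 2 else 0 with ha
  -- hypothesis (45) of Lemma 5.6
  have hC : ∀ ρ : ℕ, 1 ≤ ρ → ∀ k : ℤ, (p : ℤ_[p]) ^ ρ ∣ Cf ρ k - Cf (ρ - 1) (k / p) := by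
    intro ρ hρ k
    rcases lt_or_ge k 0 with hk | hk
    · have hkp : k / (p : ℤ) < 0 := Int.ediv_neg_of_neg_of_pos hk (by exact_mod_cast hp0)
      simp only [hCf, if_neg (not_le.mpr hk), if_neg (not_le.mpr hkp), sub_zero]
      exact dvd_zero _
    · obtain ⟨j, rfl⟩ := Int.eq_ofNat_of_zero_le hk
      have hjp : ((j : ℤ) / (p : ℤ)) = ((j / p : ℕ) : ℤ) := (Int.natCast_div j p).symm
      simp only [hCf, if_pos hk, hjp, if_pos (Int.natCast_nonneg _), Int.toNat_natCast]
      have h := (companion_modEq hp' hρ hn₁ hn₃ n₂ n₄ j).dvd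
      -- `b ≡ a` gives `n ∣ a - b`; cast into `ℤ_p`
      obtain ⟨c, hc⟩ := (Int.ModEq.dvd ((companion_modEq hp' hρ hn₁ hn₃ n₂ n₄ j).symm))
      refine ⟨(c : ℤ_[p]), ?_⟩
      have := congrArg (Int.cast : ℤ → ℤ_[p]) hc
      push_cast at this
      rw [← this]
      push_cast
      ring
  have hblocks := sum_block_dvd (R := ℤ_[p]) hp0
    (fun x hx => (mul_eq_zero.mp hx).resolve_left (by exact_mod_cast hp'.ne_zero)) Cf hC r a
    (block_sum_weights (p := p) h5) 
  -- sum the blocks `0 ≤ l < n₁`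
  have hsum : (p : ℤ_[p]) ^ r ∣ ∑ l ∈ range n₁, ∑ k ∈ block p (l : ℤ) r, a k * Cf r k :=
    Finset.dvd_sum fun l _ => hblocks l
  rw [sum_range_blocks hp0 r (fun k => a k * Cf r k) n₁] at hsum
  have heq : ∑ k ∈ range (n₁ * p ^ r), a (k : ℤ) * Cf r (k : ℤ) = ∑ k ∈ range (n₁ * p ^ r),
      (Ring.inverse ((k : ℤ_[p]))) ^ 2 *
        (((p ^ r * n₁ - 1).choose k * (p ^ r * n₃ - 1).choose k *
          (p ^ r * n₁ + p ^ r * n₂ - k - 1).choose (p ^ r * n₁) *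
          (p ^ r * n₃ + p ^ r * n₄ - k - 1).choose (p ^ r * n₃) : ℕ) : ℤ_[p]) := by
    refine Finset.sum_congr rfl fun k _ => ?_
    simp only [ha, hCf, Int.natCast_pos, if_pos (Int.natCast_nonneg k), Int.toNat_natCast]
    rcases Nat.eq_zero_or_pos k with h0 | hk
    · subst h0
      simp
    · rw [if_pos hk]
  rwa [heq] at hsum


/-- **`G₀(p^r 𝐧) ≡ 0 (mod p^{3r})`** (Straub, proof of Thm 1.2, the case `ℓ = 2`, `max λ ≤ 2`, λ = (2,2)):
for a prime `p ≥ 5`, `r ≥ 1` and all `𝐧 ∈ ℤ_{≥0}^4`,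
`p^{3r} ∣ Σ_{0 ≤ k ≤ p^r n₁, p ∤ k} C(p^r n₁, k) C(p^r n₃, k) C(p^r n₁ + p^r n₂ − k, p^r n₁) C(p^r n₃ + p^r n₄ − k, p^r n₃)`.
Route as printed: `A(p^r 𝐧; k) = p^{2r} n₁ n₃ k⁻² B(p^r 𝐧; k)` in `ℤ_p`, `B(p^r 𝐧; k) = C(p^r 𝐧; k − 1) ≡
C(p^r 𝐧; k) (mod p^r)` for `p ∤ k`, and (46) `Σ_{p∤k} k⁻² C(p^r 𝐧; k) ≡ 0 (mod p^r)` by Lemma 5.6.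
[cite: Straub2014, Theorem 1.2 (proof, (46))] -/
theorem pow_dvd_sum_not_dvd_term (h5 : 5 ≤ p) {r : ℕ} (hr : 1 ≤ r) (n₁ n₂ n₃ n₄ : ℕ) :
    (p : ℤ) ^ (3 * r) ∣ ∑ k ∈ range (p ^ r * n₁ + 1),
      (if p ∣ k then 0 else
        (((p ^ r * n₁).choose k * (p ^ r * n₃).choose k * (p ^ r * n₁ + p ^ r * n₂ - k).choose (p ^ r * n₁) *
          (p ^ r * n₃ + p ^ r * n₄ - k).choose (p ^ r * n₃) : ℕ) : ℤ)) := by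
  have hp' := hp.out
  have hp0 : 0 < p := hp'.pos
  -- degenerate cases `n₁ = 0` or `n₃ = 0`: every term vanishes
  have hdeg : n₁ = 0 ∨ n₃ = 0 → ∀ k ∈ range (p ^ r * n₁ + 1),
      (if p ∣ k then (0 : ℤ) else
        (((p ^ r * n₁).choose k * (p ^ r * n₃).choose k * (p ^ r * n₁ + p ^ r * n₂ - k).choose (p ^ r * n₁) *
          (p ^ r * n₃ + p ^ r * n₄ - k).choose (p ^ r * n₃) : ℕ) : ℤ)) = 0 := by
    intro hn k _
    split_ifs with hk
    · rfl
    · have hk1 : 1 ≤ k := Nat.one_le_iff_ne_zero.mpr fun h => hk (h ▸ dvd_zero p)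
      rcases hn with h | h <;> subst h <;>
        simp [Nat.choose_eq_zero_of_lt (show 0 < k from hk1)]
  rcases Nat.eq_zero_or_pos n₁ with h0 | hn₁
  · rw [Finset.sum_eq_zero (hdeg (Or.inl h0))]; exact dvd_zero _
  rcases Nat.eq_zero_or_pos n₃ with h0 | hn₃
  · rw [Finset.sum_eq_zero (hdeg (Or.inr h0))]; exact dvd_zero _
  -- pass to `ℤ_p`
  rw [show ((p : ℤ) ^ (3 * r)) = ((p ^ (3 * r) : ℕ) : ℤ) by push_cast; rfl]
  rw [show ((p ^ (3 * r) : ℕ) : ℤ) = (p ^ (3 * r) : ℤ) by push_cast; rfl, ← PadicInt.pow_p_dvd_int_iff]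
  push_cast
  -- Step A/B: `A(p^r 𝐧; k) = k⁻² · p^{2r} n₁ n₃ · B(p^r 𝐧; k)` termwise (`p ∤ k`), `0 = 0` otherwise
  have hterm : ∀ k ∈ range (p ^ r * n₁ + 1),
      (if p ∣ k then (0 : ℤ_[p]) else
        ((((p ^ r * n₁).choose k : ℕ) : ℤ_[p]) * (((p ^ r * n₃).choose k : ℕ) : ℤ_[p]) *
          (((p ^ r * n₁ + p ^ r * n₂ - k).choose (p ^ r * n₁) : ℕ) : ℤ_[p]) *
          (((p ^ r * n₃ + p ^ r * n₄ - k).choose (p ^ r * n₃) : ℕ) : ℤ_[p]))) =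
      ((p : ℤ_[p]) ^ (2 * r) * (n₁ * n₃ : ℕ)) * ((Ring.inverse ((k : ℤ_[p]))) ^ 2 *
        (((p ^ r * n₁ - 1).choose (k - 1) * (p ^ r * n₃ - 1).choose (k - 1) *
          (p ^ r * n₁ + p ^ r * n₂ - k).choose (p ^ r * n₁) *
          (p ^ r * n₃ + p ^ r * n₄ - k).choose (p ^ r * n₃) : ℕ) : ℤ_[p])) := by
    intro k _
    split_ifs with hk
    · rw [ringInverse_natCast_of_dvd hk, zero_pow two_ne_zero, zero_mul, mul_zero]
    · have hk1 : 1 ≤ k := Nat.one_le_iff_ne_zero.mpr fun h => hk (h ▸ dvd_zero p)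
      have hid := sq_mul_term_eq (m₁ := p ^ r * n₁) (m₂ := p ^ r * n₂) (m₃ := p ^ r * n₃) (m₄ := p ^ r * n₄) hk1
      have hinv := ringInverse_natCast_mul_self (p := p) hk
      have hcast := congrArg (Nat.cast : ℕ → ℤ_[p]) hid
      push_cast at hcast ⊢
      calc _ = (Ring.inverse ((k : ℤ_[p])) * (k : ℤ_[p])) ^ 2 *
            (((p ^ r * n₁).choose k : ℤ_[p]) * ((p ^ r * n₃).choose k : ℤ_[p]) *
              ((p ^ r * n₁ + p ^ r * n₂ - k).choose (p ^ r * n₁) : ℤ_[p]) *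
              ((p ^ r * n₃ + p ^ r * n₄ - k).choose (p ^ r * n₃) : ℤ_[p])) := by rw [hinv, one_pow, one_mul]
        _ = (Ring.inverse ((k : ℤ_[p]))) ^ 2 * ((k : ℤ_[p]) ^ 2 *
            (((p ^ r * n₁).choose k : ℤ_[p]) * ((p ^ r * n₃).choose k : ℤ_[p]) *
              ((p ^ r * n₁ + p ^ r * n₂ - k).choose (p ^ r * n₁) : ℤ_[p]) *
              ((p ^ r * n₃ + p ^ r * n₄ - k).choose (p ^ r * n₃) : ℤ_[p]))) := by ring
        _ = _ := by rw [hcast]; ring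
  rw [Finset.sum_congr rfl hterm, ← Finset.mul_sum, show 3 * r = 2 * r + r by ring, pow_add, mul_assoc]
  refine mul_dvd_mul_left _ (Dvd.dvd.mul_left ?_ _)
  -- Step C: `p^r ∣ Σ_k k⁻² B(p^r 𝐧; k)`
  -- C1: `B(p^r 𝐧; k) ≡ C(p^r 𝐧; k) (mod p^r)` termwise for `p ∤ k`
  have hC1 : (p : ℤ_[p]) ^ r ∣ ∑ k ∈ range (p ^ r * n₁ + 1), ((Ring.inverse ((k : ℤ_[p]))) ^ 2 *
        (((p ^ r * n₁ - 1).choose (k - 1) * (p ^ r * n₃ - 1).choose (k - 1) *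
          (p ^ r * n₁ + p ^ r * n₂ - k).choose (p ^ r * n₁) *
          (p ^ r * n₃ + p ^ r * n₄ - k).choose (p ^ r * n₃) : ℕ) : ℤ_[p]) -
      (Ring.inverse ((k : ℤ_[p]))) ^ 2 *
        (((p ^ r * n₁ - 1).choose k * (p ^ r * n₃ - 1).choose k *
          (p ^ r * n₁ + p ^ r * n₂ - k - 1).choose (p ^ r * n₁) *
          (p ^ r * n₃ + p ^ r * n₄ - k - 1).choose (p ^ r * n₃) : ℕ) : ℤ_[p])) := by
    refine Finset.dvd_sum fun k _ => ?_
    by_cases hk : p ∣ k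
    · rw [ringInverse_natCast_of_dvd hk, zero_pow two_ne_zero, zero_mul, zero_mul, sub_self]
      exact dvd_zero _
    · have hk1 : 1 ≤ k := Nat.one_le_iff_ne_zero.mpr fun h => hk (h ▸ dvd_zero p)
      rw [← mul_sub]
      refine Dvd.dvd.mul_left ?_ _
      -- `B(𝐦; k) = C(𝐦; k − 1)` and `C(p^r 𝐧; k−1) ≡ C(p^{r−1} 𝐧; [k/p]) ≡ C(p^r 𝐧; k)`
      have e1 : p ^ r * n₁ + p ^ r * n₂ - k = p ^ r * n₁ + p ^ r * n₂ - (k - 1) - 1 := by omega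
      have e3 : p ^ r * n₃ + p ^ r * n₄ - k = p ^ r * n₃ + p ^ r * n₄ - (k - 1) - 1 := by omega
      have hA := companion_modEq hp' hr hn₁ hn₃ n₂ n₄ (k - 1)
      have hB := companion_modEq hp' hr hn₁ hn₃ n₂ n₄ k
      rw [sub_one_div_eq hk1 hk] at hA
      obtain ⟨c, hc⟩ := Int.ModEq.dvd ((hA.trans hB.symm).symm)
      refine ⟨(c : ℤ_[p]), ?_⟩
      have := congrArg (Int.cast : ℤ → ℤ_[p]) hc
      push_cast at this ⊢
      rw [← e1, ← e3] at this
      linear_combination this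
  -- C2: the weighted companion sum, whose last term (`k = N`, `p ∣ N`) vanishes
  have hC2 : (p : ℤ_[p]) ^ r ∣ ∑ k ∈ range (p ^ r * n₁ + 1), (Ring.inverse ((k : ℤ_[p]))) ^ 2 *
        (((p ^ r * n₁ - 1).choose k * (p ^ r * n₃ - 1).choose k *
          (p ^ r * n₁ + p ^ r * n₂ - k - 1).choose (p ^ r * n₁) *
          (p ^ r * n₃ + p ^ r * n₄ - k - 1).choose (p ^ r * n₃) : ℕ) : ℤ_[p]) := by
    have hpN : p ∣ p ^ r * n₁ := Dvd.dvd.mul_right (dvd_pow_self p (by omega)) n₁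
    rw [Finset.sum_range_succ, ringInverse_natCast_of_dvd hpN, zero_pow two_ne_zero, zero_mul, add_zero]
    have hW := pow_dvd_sum_weights_companion (p := p) h5 r hn₁ hn₃ n₂ n₄
    rwa [mul_comm n₁ (p ^ r)] at hW
  have := dvd_add hC1 hC2
  rw [← Finset.sum_add_distrib] at this
  simpa using this

end GZero

end Literature.Combinatorics.Enumerative.MultivariateAperyPrimePowerProofs
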